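import Literature.NumberTheory.EllipticCurves.SelmerRestrictionCorankRelative
import Literature.NumberTheory.EllipticCurves.PeriodIndexCorestrictionLocal
import Summits.BirchSwinnertonDyer.Rank1Residual.X11b.AnticyclotomicSelmer
import HarnessLib

set_option linter.dupNamespace false -- `Summit.BirchSwinnertonDyer.BirchSwinnertonDyer.Theorems.…` (summit = sub)
set_option autoImplicit false

/-!
# Crux `EisensteinHeartFlatCMInertBadKPrime` (stmt-BirchSwinnertonDyer-21341), line `hsieh-lambda`, layer 2 (V3), part 5:
# restriction to a sub-extension of degree prime to the coefficients — INJECTIVE, ONTO THE INVARIANTS, and the same for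
# Castella's Selmer groups `Sel_𝔭^Σ(K̄^H, M)`

Route `BiquadraticEisensteinDescent` (cell `pub/bsd-wall`, width-prover seat `bsd-wall-cm-bed-w1` g5, D-0152 M1). This is the
Galois-cohomological input of the datum `(N, σ, g)` consumed by the landed socket
`…ShapiroSocket.charIdeal_eq_map_of_involution_of_surjective` (p600402): there `g : X_L ↠ X_{K′}` is the Pontryagin dual of
the restriction `Sel(K′_∞) → Sel(L·K′_∞)` along the quadratic extension `L = K′·K_CM` of the Heegner field `K′` (inside the
anticyclotomic tower), and the two facts needed are: restriction is INJECTIVE (⟹ `g` onto) and its image is the subgroup of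
`Gal(L/K′)`-invariants (⟹ `ker g ⊆ X_L⁻`). Both are "`cor ∘ res = [B : A]`, `res ∘ cor = Nm`" (the tree's corestriction,
`PeriodIndexCorestriction`, `SelmerRestrictionCorankRelative`) for an index prime to the coefficients:

* §1 (generic, any topological group `G`, subgroups `A ≤ B`, `A` relatively open of finite index in `B`, discrete
  `G`-module `M` on which `n` is invertible, `[B : A] ∣ n`): `nsmul_subgroupH1_bijective` (`n` is invertible on `H¹(B, M)`),
  `resOfLe_injective_of_relIndex_dvd`, `exists_resOfLe_eq_of_forall_conjH1_eq` (every `B`-invariant class of `H¹(A, M)` is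
  a restriction), and the sub-extension form `A = B ⊓ U` for an open normal subgroup `U` of `G` of index dividing `n`.
* §2 (number field `K`, `G = Γ_K`, normal subgroups `H′ ≤ H`): `resOfLe_mem_selmerOver` (restriction maps
  `Sel_𝔭^Σ(K̄^H, M)` into `Sel_𝔭^Σ(K̄^{H′}, M)`, no index hypothesis) and `mem_selmerOver_of_resOfLe_mem` (for `H′ = H ⊓ U`, `U`
  open normal of index dividing `n`, `n` invertible on `M`: a class whose restriction lies in `Sel_𝔭^Σ(K̄^{H′}, M)` lies in
  `Sel_𝔭^Σ(K̄^H, M)` — the local conditions are restrictions to `H ⊓ D`, `H′ ⊓ D` of relative index dividing `n`, §1 again).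

THEOREMS ONLY (no definition, no named fact, no instance, no `sorry`); imports no `Theses` module; nothing about the crux's
input or any case of BSD is asserted; BSD is not proved by any of this. Supports stmt-BirchSwinnertonDyer-21341 as a helper.

References: [SerreGaloisCohomology1997] I.§2.4 (Prop. 9: `cor ∘ res = (G : H)`); [NeukirchSchmidtWingberg2008] (1.6.2)–(1.6.5),
I.§5; [DokchitserDokchitserAnnals2010] Lemma 4.14 (proof); [Castella2018] Def. 2.2; [Greenberg1989] §1 p. 98.
-/

noncomputable section

open scoped Classical

universe u

open NumberField IsDedekindDomain Field
  Literature.NumberTheory.EllipticCurves Literature.NumberTheory.EllipticCurves.GreenbergSelmer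
  Literature.NumberTheory.GaloisRepresentations
  Summit.BirchSwinnertonDyer.Rank1Residual.X11b.AcSelmer

namespace Summit.BirchSwinnertonDyer.BirchSwinnertonDyer.Theorems.BiquadraticEisensteinDescentEisensteinHeartFlatCMInertBadKPrimeIndexTwoRestriction

/-! ## §1 Generic: restriction along a relatively open subgroup of finite index prime to the coefficients -/

section Generic

variable {G : Type u} [Group G] [TopologicalSpace G] [IsTopologicalGroup G]
variable (M : Type u) [AddCommGroup M] [DistribMulAction G M] [TopologicalSpace M] [DiscreteTopology M]

/-- **Multiplication by `n` on `H¹(B, M)` is the map induced by the coefficient map `m ↦ n • m`.** [folklore] -/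
theorem resH1Hom_nsmul_eq (B : Subgroup G) (n : ℕ) (x : subgroupH1 B M) :
    resH1Hom (ContinuousMonoidHom.id B) (DistribSMul.toAddMonoidHom M n)
      (fun g m ↦ (smul_comm (n : ℕ) g m)) x = n • x := by
  obtain ⟨f, rfl⟩ := oneCocycleClass_surjective _ x
  rw [resH1Hom_oneCocycleClass]
  have e : contOneCocycles.pullback (ContinuousMonoidHom.id B)
      (resHomOfEquivariant (ContinuousMonoidHom.id B) (DistribSMul.toAddMonoidHom M n)
        (fun g m ↦ (smul_comm (n : ℕ) g m))) f = n • f := by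
    apply Subtype.ext
    ext g
    rw [pullback_resHomOfEquivariant_apply, nsmul_apply_val]
    rfl
  rw [e]
  exact map_nsmul (oneCocycleClassₗ (discreteTopRep B M)) n f

/-- **If `n` is invertible on `M`, it is invertible on `H¹(B, M)`**: the coefficient isomorphism `m ↦ n • m` induces an
automorphism of `H¹(B, M)` (`h1Equiv`), which is multiplication by `n`. [folklore] -/
theorem nsmul_subgroupH1_bijective (B : Subgroup G) {n : ℕ} (hn : Function.Bijective fun m : M ↦ n • m) :
    Function.Bijective fun x : subgroupH1 B M ↦ n • x := by
  let θ : M ≃+ M := AddEquiv.ofBijective (DistribSMul.toAddMonoidHom M n) hn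
  have hθ : ∀ (g : B) (m : M), θ (g • m) = g • θ m := fun g m ↦ smul_comm (n : ℕ) g m
  have e : ⇑(h1Equiv θ hθ) = fun x : subgroupH1 B M ↦ n • x := by
    funext x
    rw [h1Equiv_apply]
    exact resH1Hom_nsmul_eq M B n x
  rw [← e]
  exact (h1Equiv θ hθ).bijective

variable {A B : Subgroup G}

/-- **Restriction along an index prime to the coefficients is injective.** `A ≤ B` with `A ∩ B` open and of finite index
in `B`, `[B : A] ∣ n`, `n` invertible on `M` ⟹ `res : H¹(B, M) → H¹(A, M)` is injective (its kernel is killed by `[B : A]`,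
`cor ∘ res`). [cite: SerreGaloisCohomology1997, I.§2.4 Prop. 9] -/
theorem resOfLe_injective_of_relIndex_dvd (h : A ≤ B) (hA : IsOpen (A.subgroupOf B : Set B))
    [(A.subgroupOf B).FiniteIndex] {n : ℕ} (hdvd : A.relIndex B ∣ n)
    (hn : Function.Bijective fun m : M ↦ n • m) : Function.Injective (resOfLe M h) := by
  rw [injective_iff_map_eq_zero]
  intro x hx
  have h0 : resSubgroupH1 (A.subgroupOf B) M x = 0 := by
    rw [resSubgroupH1_subgroupOf_eq M h, hx, map_zero]
  haveI : Fintype (B ⧸ A.subgroupOf B) := Fintype.ofFinite _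
  have hkill : A.relIndex B • x = 0 := index_nsmul_eq_zero_of_resSubgroupH1_eq_zero (A.subgroupOf B) hA h0
  obtain ⟨k, hk⟩ := hdvd
  apply (nsmul_subgroupH1_bijective M B hn).1
  change n • x = n • (0 : subgroupH1 B M)
  rw [nsmul_zero, hk, mul_nsmul, hkill, nsmul_zero]

/-- Relative-openness variant of the tree's `exists_resOfLe_eq_relIndex_nsmul` (there `A` is assumed open in `G`; only the
openness of `A ∩ B` in `B` is used): `[B : A] • H¹(A, M)^B ⊆ res H¹(B, M)`.
[cite: DokchitserDokchitserAnnals2010, Lemma 4.14 (proof)] -/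
theorem exists_resOfLe_eq_relIndex_nsmul' [A.Normal] (h : A ≤ B) (hA : IsOpen (A.subgroupOf B : Set B))
    [(A.subgroupOf B).FiniteIndex] {y : subgroupH1 A M} (hy : ∀ g : B, conjH1 A M (g : G) y = y) :
    ∃ x : subgroupH1 B M, resOfLe M h x = A.relIndex B • y := by
  have hinv : ∀ g : B, conjH1 (A.subgroupOf B) M g (toSubgroupOfH1 A B M y) = toSubgroupOfH1 A B M y :=
    fun g ↦ by rw [conjH1_toSubgroupOfH1, hy]
  haveI : Fintype (B ⧸ A.subgroupOf B) := Fintype.ofFinite _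
  obtain ⟨x, hx⟩ := exists_resSubgroupH1_eq_index_nsmul_of_forall_conjH1_eq (A.subgroupOf B) hA hinv
  refine ⟨x, ?_⟩
  rw [← ofSubgroupOfH1_resSubgroupH1 M h, hx, map_nsmul, ofSubgroupOfH1_toSubgroupOfH1]
  rfl

/-- **Restriction along an index prime to the coefficients is onto the invariants.** `A ≤ B`, `A` normal in `G`, `A ∩ B` open
of finite index in `B`, `[B : A] ∣ n`, `n` invertible on `M`: every class of `H¹(A, M)` fixed by `conj_g` for all `g ∈ B` is a
restriction from `B` (`res ∘ cor = Nm`, then divide by `n`). [cite: SerreGaloisCohomology1997, I.§2.4]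
[cite: DokchitserDokchitserAnnals2010, Lemma 4.14 (proof)] -/
theorem exists_resOfLe_eq_of_forall_conjH1_eq [A.Normal] (h : A ≤ B) (hA : IsOpen (A.subgroupOf B : Set B))
    [(A.subgroupOf B).FiniteIndex] {n : ℕ} (hdvd : A.relIndex B ∣ n)
    (hn : Function.Bijective fun m : M ↦ n • m) {y : subgroupH1 A M} (hy : ∀ g : B, conjH1 A M (g : G) y = y) :
    ∃ x : subgroupH1 B M, resOfLe M h x = y := by
  have hbij := nsmul_subgroupH1_bijective M A hn
  obtain ⟨y', rfl⟩ := hbij.2 y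
  -- `y'` is again invariant: `conj_g y' - y'` is killed by `n`
  have hy' : ∀ g : B, conjH1 A M (g : G) y' = y' := fun g ↦ hbij.1 (by
    change n • conjH1 A M (g : G) y' = n • y'
    rw [← map_nsmul]; exact hy g)
  obtain ⟨x, hx⟩ := exists_resOfLe_eq_relIndex_nsmul' M h hA hy'
  obtain ⟨k, hk⟩ := hdvd
  refine ⟨k • x, ?_⟩
  change resOfLe M h (k • x) = n • y'
  rw [map_nsmul, hx, ← mul_nsmul, ← hk]

/-- For `c ∈ B` with `c * c ∈ A` (`A` normal), `conj_c` is an involution of `H¹(A, M)`: `conj_c ∘ conj_c = conj_{c²} = id`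
(`conjH1_mul`, `conjH1_of_mem`). [cite: NeukirchSchmidtWingberg2008, (1.6.3)] -/
theorem conjH1_conjH1_of_mul_self_mem [A.Normal] {c : G} (hc : c * c ∈ A) (y : subgroupH1 A M) :
    conjH1 A M c (conjH1 A M c y) = y := by
  rw [← AddMonoidHom.comp_apply, ← conjH1_mul_holds A M c c, conjH1_of_mem_holds A M hc, AddMonoidHom.id_apply]

/-- For `A ≤ B` of relative index `2`, `c ∈ B ∖ A`, `A` normal: a class of `H¹(A, M)` fixed by `conj_c` is fixed by `conj_g` for
every `g ∈ B` (`B = A ∪ A c`, and `A` acts trivially). [cite: NeukirchSchmidtWingberg2008, (1.6.3)] -/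
theorem forall_conjH1_eq_of_conjH1_eq [A.Normal] {c : G} (h2 : ∀ b ∈ B, b * c⁻¹ ∈ A ∨ b ∈ A)
    {y : subgroupH1 A M} (hy : conjH1 A M c y = y) (g : B) : conjH1 A M (g : G) y = y := by
  rcases h2 g g.2 with hg | hg
  · have e : (g : G) = ((g : G) * c⁻¹) * c := by rw [inv_mul_cancel_right]
    rw [e, conjH1_mul_holds A M, AddMonoidHom.comp_apply, hy, conjH1_of_mem_holds A M hg, AddMonoidHom.id_apply]
  · rw [conjH1_of_mem_holds A M hg, AddMonoidHom.id_apply]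


/-! ### §1b The sub-extension form: `A ∩ B = U ∩ B` for an open normal subgroup `U` of finite index dividing `n` -/

omit [TopologicalSpace G] [IsTopologicalGroup G] in
/-- If `A ∩ B = U ∩ B` then `A.subgroupOf B = U.subgroupOf B`. [folklore] -/
theorem subgroupOf_eq_of_forall_mem_iff {U : Subgroup G} (hAB : ∀ x ∈ B, x ∈ A ↔ x ∈ U) :
    A.subgroupOf B = U.subgroupOf B := by
  ext x
  rw [Subgroup.mem_subgroupOf, Subgroup.mem_subgroupOf]
  exact hAB x x.2

omit [IsTopologicalGroup G] in
/-- `A ∩ B = U ∩ B` with `U` open ⟹ `A ∩ B` is open in `B`. [folklore] -/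
theorem isOpen_subgroupOf_of_forall_mem_iff {U : Subgroup G} (hAB : ∀ x ∈ B, x ∈ A ↔ x ∈ U)
    (hU : IsOpen (U : Set G)) : IsOpen (A.subgroupOf B : Set B) := by
  rw [subgroupOf_eq_of_forall_mem_iff hAB]
  exact isOpen_subgroupOf hU

omit [TopologicalSpace G] [IsTopologicalGroup G] in
/-- `A ∩ B = U ∩ B` with `U` normal ⟹ `[B : A]` divides `[G : U]`. [folklore] -/
theorem relIndex_dvd_index_of_forall_mem_iff {U : Subgroup G} [U.Normal] (hAB : ∀ x ∈ B, x ∈ A ↔ x ∈ U) :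
    A.relIndex B ∣ U.index := by
  rw [Subgroup.relIndex, subgroupOf_eq_of_forall_mem_iff hAB]
  exact Subgroup.relIndex_dvd_index_of_normal U B

omit [TopologicalSpace G] [IsTopologicalGroup G] in
/-- `A ∩ B = U ∩ B` with `U` normal of finite index ⟹ `A ∩ B` has finite index in `B`. [folklore] -/
theorem finiteIndex_subgroupOf_of_forall_mem_iff {U : Subgroup G} [U.Normal] [U.FiniteIndex]
    (hAB : ∀ x ∈ B, x ∈ A ↔ x ∈ U) : (A.subgroupOf B).FiniteIndex := by
  refine ⟨fun h0 ↦ Subgroup.FiniteIndex.index_ne_zero (H := U) (Nat.eq_zero_of_zero_dvd ?_)⟩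
  have h := relIndex_dvd_index_of_forall_mem_iff (A := A) (B := B) hAB
  rwa [Subgroup.relIndex, h0] at h

/-- **Injectivity, sub-extension form.** `A ≤ B`, `A ∩ B = U ∩ B` for an open normal subgroup `U` of `G` of index dividing `n`,
`n` invertible on `M` ⟹ `res : H¹(B, M) → H¹(A, M)` is injective. [cite: SerreGaloisCohomology1997, I.§2.4 Prop. 9] -/
theorem resOfLe_injective_of_forall_mem_iff (h : A ≤ B) {U : Subgroup G} [U.Normal] [U.FiniteIndex]
    (hU : IsOpen (U : Set G)) (hAB : ∀ x ∈ B, x ∈ A ↔ x ∈ U) {n : ℕ} (hdvd : U.index ∣ n)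
    (hn : Function.Bijective fun m : M ↦ n • m) : Function.Injective (resOfLe M h) := by
  haveI := finiteIndex_subgroupOf_of_forall_mem_iff (A := A) (B := B) hAB
  exact resOfLe_injective_of_relIndex_dvd M h (isOpen_subgroupOf_of_forall_mem_iff hAB hU)
    ((relIndex_dvd_index_of_forall_mem_iff hAB).trans hdvd) hn

/-- **Onto the invariants, sub-extension form.** `A ≤ B`, `A` normal, `A ∩ B = U ∩ B` for an open normal subgroup `U` of index
dividing `n`, `n` invertible on `M` ⟹ every `B`-invariant class of `H¹(A, M)` is a restriction from `B`.
[cite: DokchitserDokchitserAnnals2010, Lemma 4.14 (proof)] -/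
theorem exists_resOfLe_eq_of_forall_conjH1_eq_of_forall_mem_iff [A.Normal] (h : A ≤ B) {U : Subgroup G} [U.Normal]
    [U.FiniteIndex] (hU : IsOpen (U : Set G)) (hAB : ∀ x ∈ B, x ∈ A ↔ x ∈ U) {n : ℕ} (hdvd : U.index ∣ n)
    (hn : Function.Bijective fun m : M ↦ n • m) {y : subgroupH1 A M} (hy : ∀ g : B, conjH1 A M (g : G) y = y) :
    ∃ x : subgroupH1 B M, resOfLe M h x = y := by
  haveI := finiteIndex_subgroupOf_of_forall_mem_iff (A := A) (B := B) hAB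
  exact exists_resOfLe_eq_of_forall_conjH1_eq M h (isOpen_subgroupOf_of_forall_mem_iff hAB hU)
    ((relIndex_dvd_index_of_forall_mem_iff hAB).trans hdvd) hn hy

/-- Restricting further commutes: `res_{A → A ⊓ C} ∘ res_{B → A} = res_{B ⊓ C → A ⊓ C} ∘ res_{B → B ⊓ C}` (both are
`res_{B → A ⊓ C}`; `resOfLe_comp`). [cite: NeukirchSchmidtWingberg2008, I.§5] -/
theorem resOfLe_inf_resOfLe (h : A ≤ B) (C : Subgroup G) (x : subgroupH1 B M) :
    resOfLe M (inf_le_left : A ⊓ C ≤ A) (resOfLe M h x) =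
      resOfLe M (inf_le_inf_right C h : A ⊓ C ≤ B ⊓ C) (resOfLe M (inf_le_left : B ⊓ C ≤ B) x) := by
  rw [← AddMonoidHom.comp_apply, resOfLe_comp_holds, ← AddMonoidHom.comp_apply, resOfLe_comp_holds]

end Generic

/-! ## §2 Castella's Selmer groups `Sel_𝔭^Σ(K̄^H, M)` under restriction `H′ ≤ H` -/

section Selmer

variable {K : Type u} [Field K] [NumberField K]
variable (M : Type u) [AddCommGroup M] [DistribMulAction (absoluteGaloisGroup K) M] [TopologicalSpace M]
  [DiscreteTopology M]
variable {H' H : Subgroup (absoluteGaloisGroup K)}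

/-- `H′ ≤ H ⟹ decompIn H′ v ≤ decompIn H v` (the local groups `H′ ⊓ D_v ≤ H ⊓ D_v` inside `D_v`). [folklore] -/
theorem decompIn_mono (h : H' ≤ H) (v : HeightOneSpectrum (𝓞 K)) : decompIn H' v ≤ decompIn H v :=
  fun x hx ↦ (mem_decompIn_iff H v x).2 (h ((mem_decompIn_iff H' v x).1 hx))

/-- **The strict local map commutes with restriction**: `strictMap_{H′} ∘ res_{H → H′} = res_{D(H) → D(H′)} ∘ strictMap_H`
(both are the map of the pair `(H′ ⊓ D_v → H, M ↠ M ⧸ M⁺_v)`). [cite: Greenberg1989, §1 p. 98] -/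
theorem strictMap_resOfLe (h : H' ≤ H) {v : HeightOneSpectrum (𝓞 K)} (N : LocalDatum K M v) (x : subgroupH1 H M) :
    N.strictMap H' (resOfLe M h x) = resOfLe N.Gr (decompIn_mono h v) (N.strictMap H x) := by
  rw [LocalDatum.strictMap, LocalDatum.strictMap, resOfLe, resOfLe, resH1Hom_resH1Hom, resH1Hom_resH1Hom]
  exact DFunLike.congr_fun (resH1Hom_congr (by ext; rfl) (by ext; rfl) _ _) x

variable [H'.Normal] [H.Normal]

omit [NumberField K] in
/-- `conj_σ ∘ res_{H → H′} = res_{H → H′} ∘ conj_σ` (pointwise `resOfLe_comp_conjH1`). [cite: NeukirchSchmidtWingberg2008, I.§5] -/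
theorem conjH1_resOfLe (h : H' ≤ H) (σ : absoluteGaloisGroup K) (x : subgroupH1 H M) :
    conjH1 H' M σ (resOfLe M h x) = resOfLe M h (conjH1 H M σ x) :=
  (congrArg (fun f ↦ f x) (resOfLe_comp_conjH1_holds (M := M) h σ)).symm

/-- **Restriction maps `Sel_𝔭^Σ(K̄^H, M)` into `Sel_𝔭^Σ(K̄^{H′}, M)`** for normal subgroups `H′ ≤ H` of `Γ_K` (each local
condition is a further restriction, and restriction commutes with conjugation). [cite: Castella2018, Def. 2.2]
[cite: GreenbergLNM1716, §1 ("the natural restriction maps")] -/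
theorem resOfLe_mem_selmerOver (h : H' ≤ H) {p : ℕ} {𝔭 : HeightOneSpectrum (𝓞 K)} {S : Set (HeightOneSpectrum (𝓞 K))}
    {c : subgroupH1 H M} (hc : c ∈ selmerOver H M p 𝔭 S) : resOfLe M h c ∈ selmerOver H' M p 𝔭 S := by
  rw [mem_selmerOver_iff] at hc ⊢
  refine ⟨fun v hv hvS σ ↦ ?_, fun w σ ↦ ?_, fun σ ↦ ?_⟩
  · rw [conjH1_resOfLe, awayKer, AddMonoidHom.mem_ker, resOfLe_inf_resOfLe,
      (AddMonoidHom.mem_ker.1 (hc.1 v hv hvS σ) : resOfLe M _ _ = 0), map_zero]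
  · rw [conjH1_resOfLe, infKer, AddMonoidHom.mem_ker, resOfLe_inf_resOfLe,
      (AddMonoidHom.mem_ker.1 (hc.2.1 w σ) : resOfLe M _ _ = 0), map_zero]
  · rw [conjH1_resOfLe, LocalDatum.mem_strictKer_iff, strictMap_resOfLe,
      (LocalDatum.mem_strictKer_iff _ _ _).1 (hc.2.2 σ), map_zero]

omit [TopologicalSpace M] [DiscreteTopology M] [H'.Normal] [H.Normal] in
/-- `n` invertible on `M` ⟹ `n` invertible on `M ⧸ M⁺` for the STRICT datum `M⁺ = 0`. [folklore] -/
theorem nsmul_bijective_gr_strictDatum (v : HeightOneSpectrum (𝓞 K)) {n : ℕ} (hn : Function.Bijective fun m : M ↦ n • m) :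
    Function.Bijective fun m : (strictDatum M v).Gr ↦ n • m := by
  have hinj : Function.Injective (strictDatum M v).grMk := by
    rw [injective_iff_map_eq_zero]
    intro m hm
    rw [← AddMonoidHom.mem_ker, LocalDatum.ker_grMk] at hm
    exact (AddSubgroup.mem_bot).1 hm
  let θ : M ≃+ (strictDatum M v).Gr := AddEquiv.ofBijective _ ⟨hinj, (strictDatum M v).grMk_surjective⟩
  have e : (fun m : (strictDatum M v).Gr ↦ n • m) = θ ∘ (fun m : M ↦ n • m) ∘ θ.symm := by
    funext m
    simp only [Function.comp_apply, map_nsmul, AddEquiv.apply_symm_apply]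
  rw [e]
  exact θ.bijective.comp (hn.comp θ.symm.bijective)

/-- **The converse for a sub-extension of index dividing `n`, `n` invertible on `M`.** Let `U ≤ Γ_K` be an open normal subgroup
of index dividing `n` (e.g. `U = Γ_L`, `[L : K] = n`), `H` normal, `H′ := H ⊓ U`. If `n` is invertible on `M`, then a class
`c ∈ H¹(H, M)` whose restriction lies in `Sel_𝔭^Σ(K̄^{H′}, M)` already lies in `Sel_𝔭^Σ(K̄^H, M)`: each local condition is the
vanishing of a restriction to `H ⊓ D`, and `res : H¹(H ⊓ D, ·) → H¹(H′ ⊓ D, ·)` is injective (§1, relative index dividing `n`).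
[cite: DokchitserDokchitserAnnals2010, Lemma 4.14 (proof)] [cite: Castella2018, Def. 2.2] -/
theorem mem_selmerOver_of_resOfLe_mem (U : Subgroup (absoluteGaloisGroup K)) [U.Normal] [U.FiniteIndex]
    (hU : IsOpen (U : Set (absoluteGaloisGroup K))) (hH' : ∀ x ∈ H, x ∈ H' ↔ x ∈ U) (h : H' ≤ H) {n : ℕ}
    (hdvd : U.index ∣ n) (hn : Function.Bijective fun m : M ↦ n • m)
    {p : ℕ} {𝔭 : HeightOneSpectrum (𝓞 K)} {S : Set (HeightOneSpectrum (𝓞 K))}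
    {c : subgroupH1 H M} (hc : resOfLe M h c ∈ selmerOver H' M p 𝔭 S) : c ∈ selmerOver H M p 𝔭 S := by
  rw [mem_selmerOver_iff] at hc ⊢
  refine ⟨fun v hv hvS σ ↦ ?_, fun w σ ↦ ?_, fun σ ↦ ?_⟩
  · -- away from `p`: the pair `H′ ⊓ D_v ≤ H ⊓ D_v`
    have h1 := hc.1 v hv hvS σ
    rw [conjH1_resOfLe, awayKer, AddMonoidHom.mem_ker, resOfLe_inf_resOfLe] at h1
    rw [awayKer, AddMonoidHom.mem_ker]
    refine resOfLe_injective_of_forall_mem_iff M (inf_le_inf_right (decomp v) h) hU (fun x hx ↦ ?_) hdvd hn ?_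
    · simp only [Subgroup.mem_inf] at hx ⊢
      exact ⟨fun hx' ↦ ((hH' x hx.1).1 hx'.1), fun hxU ↦ ⟨(hH' x hx.1).2 hxU, hx.2⟩⟩
    · rw [h1, map_zero]
  · -- infinite places: the pair `H′ ⊓ D_w ≤ H ⊓ D_w`
    have h1 := hc.2.1 w σ
    rw [conjH1_resOfLe, infKer, AddMonoidHom.mem_ker, resOfLe_inf_resOfLe] at h1
    rw [infKer, AddMonoidHom.mem_ker]
    refine resOfLe_injective_of_forall_mem_iff M (inf_le_inf_right (decompInf w) h) hU (fun x hx ↦ ?_) hdvd hn ?_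
    · simp only [Subgroup.mem_inf] at hx ⊢
      exact ⟨fun hx' ↦ ((hH' x hx.1).1 hx'.1), fun hxU ↦ ⟨(hH' x hx.1).2 hxU, hx.2⟩⟩
    · rw [h1, map_zero]
  · -- the strict condition at `𝔭`: the pair `decompIn H′ 𝔭 ≤ decompIn H 𝔭` inside `D_𝔭`, coefficients `M ⧸ 0`
    have h1 := hc.2.2 σ
    rw [conjH1_resOfLe, LocalDatum.mem_strictKer_iff, strictMap_resOfLe] at h1
    rw [LocalDatum.mem_strictKer_iff]
    haveI : (U.subgroupOf (decomp 𝔭)).FiniteIndex :=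
      ⟨fun h0 ↦ Subgroup.FiniteIndex.index_ne_zero (H := U) (Nat.eq_zero_of_zero_dvd (by
        have hd := Subgroup.relIndex_dvd_index_of_normal U (decomp 𝔭)
        rwa [Subgroup.relIndex, h0] at hd))⟩
    refine resOfLe_injective_of_forall_mem_iff (strictDatum M 𝔭).Gr (decompIn_mono h 𝔭)
      (U := U.subgroupOf (decomp 𝔭)) (isOpen_subgroupOf hU) (fun x hx ↦ ?_)
      ((Subgroup.relIndex_dvd_index_of_normal U (decomp 𝔭)).trans hdvd) (nsmul_bijective_gr_strictDatum M 𝔭 hn) ?_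
    · rw [mem_decompIn_iff] at hx
      rw [mem_decompIn_iff, Subgroup.mem_subgroupOf]
      exact hH' _ hx
    · rw [h1, map_zero]

/-- **Invariant Selmer classes upstairs are restrictions of Selmer classes downstairs.** Same setting (`H′ ∩ H = U ∩ H`, `U` open
normal of index dividing `n`, `n` invertible on `M`): a class `y ∈ Sel_𝔭^Σ(K̄^{H′}, M)` fixed by `conj_g` for every `g ∈ H` is
`res x` for a (unique) `x ∈ Sel_𝔭^Σ(K̄^H, M)` (§1 onto-the-invariants, then `mem_selmerOver_of_resOfLe_mem`). For `[H : H′] = 2`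
it suffices that `y` be fixed by `conj_c` for one `c ∈ H ∖ H′` (`forall_conjH1_eq_of_conjH1_eq`). This is the Selmer-level form of
`Sel(K′_∞) = Sel(L·K′_∞)^{Gal(L/K′)}` for `[L : K′]` prime to `p`. [cite: DokchitserDokchitserAnnals2010, Lemma 4.14 (proof)]
[cite: GreenbergLNM1716, §3 (restriction maps `s_n`)] -/
theorem exists_mem_selmerOver_resOfLe_eq (U : Subgroup (absoluteGaloisGroup K)) [U.Normal] [U.FiniteIndex]
    (hU : IsOpen (U : Set (absoluteGaloisGroup K))) (hH' : ∀ x ∈ H, x ∈ H' ↔ x ∈ U) (h : H' ≤ H) {n : ℕ}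
    (hdvd : U.index ∣ n) (hn : Function.Bijective fun m : M ↦ n • m)
    {p : ℕ} {𝔭 : HeightOneSpectrum (𝓞 K)} {S : Set (HeightOneSpectrum (𝓞 K))}
    {y : subgroupH1 H' M} (hySel : y ∈ selmerOver H' M p 𝔭 S) (hy : ∀ g : H, conjH1 H' M (g : absoluteGaloisGroup K) y = y) :
    ∃ x ∈ selmerOver H M p 𝔭 S, resOfLe M h x = y := by
  obtain ⟨x, rfl⟩ := exists_resOfLe_eq_of_forall_conjH1_eq_of_forall_mem_iff M h hU hH' hdvd hn hy
  exact ⟨x, mem_selmerOver_of_resOfLe_mem M U hU hH' h hdvd hn hySel, rfl⟩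

end Selmer

end Summit.BirchSwinnertonDyer.BirchSwinnertonDyer.Theorems.BiquadraticEisensteinDescentEisensteinHeartFlatCMInertBadKPrimeIndexTwoRestriction

end
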